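import Literature.NumberTheory.EllipticCurves.DeShalit1987.LMeasureCosetValuesProofs
import Literature.NumberTheory.ComplexMultiplication.EllipticUnits.KatoLayerArtinCompatibility
import Literature.NumberTheory.NumberFields.RayClassFieldSplitPrimePowerDegree
import Literature.NumberTheory.NumberFields.BigHilbertClassField
import HarnessLib

/-!
# Stub ideation k2·g47 — `stub_heegnerIndexLowerAtTwo` (crux `SplitBadTwoLowerHalfOfFacts`, route PrintCf2)

HONEST FRAMING: BSD is NOT proved; the crux is NOT proved; the stub is NOT proved. Nothing here is a
route, a proposal, or a Literature fact. This file is the KERNEL-CHECKED part of a FAMILY-1 typed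
dictionary «de Shalit (1987) II.4.8 (19) / II.4.11 (30) / II.5.2 (4) / II.1.7 ↦ the tree's receptacle
`DeShalit1987.LMeasureCosetValues{,Proofs}`» on road A″ (STUB-PLAN v8.2 §4 ORDER NOW:
`A″ FIRST … ≻ K3 typed vs the TREE (now) ≻ K2 (c)`), i.e. the two Galois-side inputs that the K3 step
(«typing the tree's two binders `χ, hχ` for the class keys») still lists as owed:

* §1 **the CFT membership lemma (D2)** — for `0 ≠ 𝔤 ≤ 𝔣` and `α ≡ 1 (mod 𝔣)`, `α ≠ 0`:
  `((α), K(𝔤)/K) ∈ Gal(K(𝔤)/K(𝔣))`, typed as membership in the tree's `relGalSet K 𝔤 𝔣`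
  (print: II.4.8 (19) "`γ ∈ Gal(F_n/F)` … `γ` determines `κ(γ) mod pⁿ`", p. 61); with the
  `κ`-representative corollaries `δ_a ∈ Gal(K(𝔣vⁿ)/K(𝔣))` and, for `a ≡ 1 (p^{n-1})`,
  `δ_a ∈ Gal(K(𝔣vⁿ)/K(𝔣v^{n-1}))`;
* §2 **`δ : (ℤ/pⁿ)ˣ → Gal(K(𝔣vⁿ)/K)` is a homomorphism independent of the representatives** (II.1.7,
  p. 37: `Gal(F(E[𝔭ⁿ])/F) ≅ (𝒪_K/𝔭ⁿ)ˣ`), so the INERTIA TYPE `χ ∘ δ` of a character `χ` of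
  `Gal(K(𝔣vⁿ)/K)` is a character of `(ℤ/pⁿ)ˣ`;
* §3 **Gauss-factor rigidity**: the tree's `gaussSumInv … χ …`, multiplied by `ι⁻¹χ(γ₀|)`, is the
  classical Gauss sum of the inertia type `χ ∘ δ` alone (print: (19) is a sum over `Gal(F_n/F)`;
  p. 80 "Note that `G(χ⁻¹) = χ⁻¹(𝔮)τ(χ⁻¹)`"), hence agrees for two characters with the same
  restriction to `Gal(K(𝔣vⁿ)/K(𝔣))`;
* §4 **K2 (c) ⇒ the binder `hχ`**: if the inertia type has exact level `n` (nontrivial on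
  `ker((ℤ/pⁿ)ˣ → (ℤ/p^{n-1})ˣ)`), then `∃ δ ∈ relGalSet K (𝔣vⁿ) (𝔣v^{n-1}), χ δ ≠ 1` — literally the
  hypothesis `hχ` of `DeShalit1987.exists_cosetValueIdentity` / `IsCosetValues`.

The smoothing factor `12(χ⁻¹(𝔞) − N𝔞) ≠ 0` is ALREADY the tree's `DeShalit1987.smoothingFactor_ne_zero`
(cited, not restated). All statements are over tree declarations; `K` totally complex where CFT is used
(de Shalit's `K` is imaginary quadratic: `IsImaginaryQuadratic K = (finrank ℚ K = 2 ∧ IsTotallyComplex K)`).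
-/

noncomputable section

set_option linter.dupNamespace false

open scoped Classical
open NumberField IsDedekindDomain Field
open Literature.NumberTheory.GaloisRepresentations
open Literature.NumberTheory.ComplexMultiplication.EllipticUnits
open Literature.NumberTheory.NumberFields
open Literature.NumberTheory.LFunctions
open Literature.NumberTheory.LFunctions.AbelianDensity (artinSymbol ArtinKillsRay artinSymbol_mul)
open Literature.NumberTheory.EllipticCurves Literature.NumberTheory.EllipticCurves.DeShalit1987

namespace Summit.BirchSwinnertonDyer.BirchSwinnertonDyer.Cruxes.SplitBadTwoLowerHalfOfFacts.GaussDictK2G47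

variable {K : Type} [Field K] [NumberField K]

/-! ## §1 The CFT membership lemma (D2): `((α), K(𝔤)/K) ∈ Gal(K(𝔤)/K(𝔣))` for `α ≡ 1 (𝔣)` -/

/-- **The Artin symbol of `K(𝔣)/K` kills the ray `P_K^𝔣`** (`K` totally complex: no sign condition).
Dictionary: Neukirch VI (7.1) `ker = P^𝔪` ↦ tree `artinHom_galFrob_rayClassField_eq_one_iff`. -/
theorem artinKillsRay_galFrob_rayClassField [IsTotallyComplex K] {𝔣 : Ideal (𝓞 K)} (h𝔣 : 𝔣 ≠ ⊥) :
    ArtinKillsRay 𝔣 (galFrob K (rayClassField K 𝔣)) := by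
  rw [artinKillsRay_iff_ray_le_ker h𝔣]
  intro I hI
  rw [MonoidHom.mem_ker]
  exact (artinHom_galFrob_rayClassField_eq_one_iff h𝔣 (ray_le_idealsPrimeTo h𝔣 hI)).mpr hI

/-- **`((α), K(𝔣)/K) = 1` for `α ≡ 1 (mod 𝔣)`, `α ≠ 0`** (principal ideals in the ray have trivial
Artin symbol in the ray class field). [de Shalit II.1.6–1.7 (p. 37): "if `𝔞 = (a)`, `a ≡ 1 mod 𝔤`, then …
`σ_𝔞` fixes `E[𝔤]` pointwise"; Neukirch VI (7.1)] -/
theorem artinSymbol_span_singleton_eq_one [IsTotallyComplex K] {𝔣 : Ideal (𝓞 K)} (h𝔣 : 𝔣 ≠ ⊥)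
    {α : 𝓞 K} (hα0 : α ≠ 0) (hα : α - 1 ∈ 𝔣) :
    artinSymbol (galFrob K (rayClassField K 𝔣)) (Ideal.span {α}) = 1 := by
  haveI := isEmpty_ringHom_real_of_isTotallyComplex K
  have hcop : IsCoprime (Ideal.span {(1 : 𝓞 K)}) 𝔣 := by
    rw [Ideal.span_singleton_one, ← Ideal.one_eq_top]; exact isCoprime_one_left
  have h := artinKillsRay_galFrob_rayClassField h𝔣 α 1 hα0 one_ne_zero hcop hα
    (fun φ ↦ isEmptyElim φ)
  rw [Ideal.span_singleton_one, artinSymbol_top] at h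
  exact h

omit [NumberField K] in
/-- `α ≡ 1 (mod 𝔣)` is prime to every `v ⊇ 𝔣`: no prime factor of `(α)` contains `𝔣`. -/
theorem not_le_of_dvd_span_singleton {𝔣 : Ideal (𝓞 K)} {α : 𝓞 K} (hα : α - 1 ∈ 𝔣)
    {v : HeightOneSpectrum (𝓞 K)} (hv : v.asIdeal ∣ Ideal.span {α}) : ¬ 𝔣 ≤ v.asIdeal := by
  intro hle
  have hαv : α ∈ v.asIdeal := Ideal.le_of_dvd hv (Ideal.mem_span_singleton_self α)
  have h1 : (1 : 𝓞 K) ∈ v.asIdeal := by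
    have := v.asIdeal.sub_mem hαv (hle hα)
    rwa [sub_sub_cancel] at this
  exact v.isPrime.ne_top ((Ideal.eq_top_iff_one _).mpr h1)

/-- **THE MEMBERSHIP LEMMA (D2).** For `0 ≠ 𝔤 ≤ 𝔣` (i.e. `𝔣 ∣ 𝔤`), `α ≠ 0`, `α ≡ 1 (mod 𝔣)`:
the Artin symbol `((α), K(𝔤)/K)` restricts trivially to `K(𝔣)`, i.e. lies in the tree's
`relGalSet K 𝔤 𝔣 = Gal(K(𝔤)/K(𝔣))`. Print: II.4.8 (19) sums over `γ ∈ Gal(F_n/F)`, `F = K(𝔣)`,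
`F_n = K(𝔣𝔭ⁿ)` (p. 61). Proof = tree CFT: Artin symbols restrict along `K(𝔣) ≤ K(𝔤)`
(`coe_artinSymbol_galFrob_inclusion_eq`, primes of `(α)` are unramified in `K(𝔣)`) + the previous lemma. -/
theorem artinSymbol_span_singleton_mem_relGalSet [IsTotallyComplex K] {𝔣 𝔤 : Ideal (𝓞 K)}
    (h𝔤 : 𝔤 ≠ ⊥) (hle : 𝔤 ≤ 𝔣) {α : 𝓞 K} (hα0 : α ≠ 0) (hα : α - 1 ∈ 𝔣) :
    artinSymbol (galFrob K (rayClassField K 𝔤)) (Ideal.span {α}) ∈ relGalSet K 𝔤 𝔣 := by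
  have h𝔣 : 𝔣 ≠ ⊥ := ne_bot_of_le_ne_bot h𝔤 hle
  have hE : rayClassField K 𝔣 ≤ rayClassField K 𝔤 := rayClassField_le_of_le h𝔤 hle
  have h0 : Ideal.span {α} ≠ ⊥ := by simpa [Ideal.span_singleton_eq_bot] using hα0
  have hunr : ∀ v : HeightOneSpectrum (𝓞 K), v.asIdeal ∣ Ideal.span {α} →
      Algebra.IsUnramifiedIn (𝓞 (rayClassField K 𝔣)) v.asIdeal :=
    fun v hv ↦ isUnramifiedIn_rayClassField h𝔣 (not_le_of_dvd_span_singleton hα hv)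
  intro y hy hy'
  have key := coe_artinSymbol_galFrob_inclusion_eq hE h0 hunr ⟨y, hy'⟩
  have key' : ((artinSymbol (galFrob K (rayClassField K 𝔣)) (Ideal.span {α}) ⟨y, hy'⟩ :
      rayClassField K 𝔣) : AlgebraicClosure K) = y := by
    rw [artinSymbol_span_singleton_eq_one h𝔣 hα0 hα]; rfl
  exact key.trans key'

/-! ### The `κ`-representatives `α_a ≡ 1 (𝔣)`, `α_a ≡ a (vⁿ)` of II.4.11 (30) -/

section KappaReps

variable {p : ℕ}

omit [NumberField K] in
/-- `α_a ∉ v` (`a` a unit mod `pⁿ`, `n ≥ 1`, `p ∈ v`); in particular `α_a ≠ 0`. -/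
theorem kappaRep_not_mem {v : HeightOneSpectrum (𝓞 K)} (hv : ((p : ℕ) : 𝓞 K) ∈ v.asIdeal)
    {n : ℕ} (hn : 1 ≤ n) (a : (ZMod (p ^ n))ˣ) {x : 𝓞 K}
    (hx : x - ((a : ZMod (p ^ n)).val : 𝓞 K) ∈ v.asIdeal ^ n) : x ∉ v.asIdeal := by
  intro hxv
  obtain ⟨s, t, hst⟩ :
      IsCoprime ((((a : ZMod (p ^ n)).val : ℕ) : 𝓞 K)) (((p ^ n : ℕ) : 𝓞 K)) :=
    (ZMod.val_coe_unit_coprime a).cast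
  have ha : (((a : ZMod (p ^ n)).val : ℕ) : 𝓞 K) ∈ v.asIdeal := by
    have := v.asIdeal.sub_mem hxv (Ideal.pow_le_self (by omega : n ≠ 0) hx)
    rwa [sub_sub_cancel] at this
  have hp : ((p ^ n : ℕ) : 𝓞 K) ∈ v.asIdeal := by
    rw [Nat.cast_pow]; exact v.asIdeal.pow_mem_of_mem hv n (by omega)
  have h1 : (1 : 𝓞 K) ∈ v.asIdeal :=
    hst ▸ v.asIdeal.add_mem (v.asIdeal.mul_mem_left s ha) (v.asIdeal.mul_mem_left t hp)
  exact v.isPrime.ne_top ((Ideal.eq_top_iff_one _).mpr h1)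

omit [NumberField K] in
/-- `α_a ≠ 0`. -/
theorem kappaRep_ne_zero {v : HeightOneSpectrum (𝓞 K)} (hv : ((p : ℕ) : 𝓞 K) ∈ v.asIdeal)
    {n : ℕ} (hn : 1 ≤ n) (a : (ZMod (p ^ n))ˣ) {x : 𝓞 K}
    (hx : x - ((a : ZMod (p ^ n)).val : 𝓞 K) ∈ v.asIdeal ^ n) : x ≠ 0 := by
  rintro rfl
  exact kappaRep_not_mem hv hn a hx (zero_mem _)

/-- **`δ_a = ((α_a), K(𝔣vⁿ)/K) ∈ Gal(K(𝔣vⁿ)/K(𝔣))`** for every `a ∈ (ℤ/pⁿ)ˣ` — the summation range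
of the tree's `gaussSumInv` is print (19)'s `Gal(F_n/F)` (II.4.8, p. 61; II.4.11 (30), p. 65–66). -/
theorem artinSymbol_kappaRep_mem_relGalSet [IsTotallyComplex K] {v : HeightOneSpectrum (𝓞 K)}
    (hv : ((p : ℕ) : 𝓞 K) ∈ v.asIdeal) {𝔣 : Ideal (𝓞 K)} (h𝔣 : 𝔣 ≠ ⊥) {n : ℕ} (hn : 1 ≤ n)
    (a : (ZMod (p ^ n))ˣ) {x : 𝓞 K} (hx1 : x - 1 ∈ 𝔣)
    (hx : x - ((a : ZMod (p ^ n)).val : 𝓞 K) ∈ v.asIdeal ^ n) :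
    artinSymbol (galFrob K (rayClassField K (𝔣 * v.asIdeal ^ n))) (Ideal.span {x}) ∈
      relGalSet K (𝔣 * v.asIdeal ^ n) 𝔣 :=
  artinSymbol_span_singleton_mem_relGalSet (mul_ne_zero h𝔣 (pow_ne_zero n v.ne_bot))
    Ideal.mul_le_right (kappaRep_ne_zero hv hn a hx) hx1

omit [NumberField K] in
/-- `a ≡ 1 (mod p^{n-1})` gives `(a : 𝓞 K) − 1 ∈ v^{n-1}` (`p ∈ v`). -/
theorem natCast_sub_one_mem_pow {v : HeightOneSpectrum (𝓞 K)} (hv : ((p : ℕ) : 𝓞 K) ∈ v.asIdeal)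
    {m a : ℕ} (ha : a ≡ 1 [MOD p ^ m]) : ((a : ℕ) : 𝓞 K) - 1 ∈ v.asIdeal ^ m := by
  have hdvd : ((p ^ m : ℕ) : ℤ) ∣ (1 : ℤ) - (a : ℤ) := by
    have := (Nat.modEq_iff_dvd.mp ha)
    simpa using this
  obtain ⟨c, hc⟩ := hdvd
  have hcast : ((a : ℕ) : 𝓞 K) - 1 = -(((p ^ m : ℕ) : 𝓞 K) * (c : 𝓞 K)) := by
    have h := congrArg (fun z : ℤ ↦ (z : 𝓞 K)) hc
    simp only [Int.cast_sub, Int.cast_one, Int.cast_natCast, Int.cast_mul] at h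
    linear_combination -h
  rw [hcast]
  refine neg_mem (Ideal.mul_mem_right _ _ ?_)
  rw [Nat.cast_pow]
  exact Ideal.pow_mem_pow hv m

/-- **Level `n−1` membership: for `a ≡ 1 (mod p^{n-1})`, `δ_a ∈ Gal(K(𝔣vⁿ)/K(𝔣v^{n-1}))`** — the
elements on which a character of EXACT `v`-level `n` must be nontrivial (the `hχ` binder of the tree's
`IsCosetValues` / `exists_cosetValueIdentity`). -/
theorem artinSymbol_kappaRep_mem_relGalSet_pred [IsTotallyComplex K] {v : HeightOneSpectrum (𝓞 K)}
    (hv : ((p : ℕ) : 𝓞 K) ∈ v.asIdeal) {𝔣 : Ideal (𝓞 K)} (h𝔣 : 𝔣 ≠ ⊥)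
    (h𝔣v : IsCoprime 𝔣 v.asIdeal) {n : ℕ} (hn : 1 ≤ n)
    (a : (ZMod (p ^ n))ˣ) {x : 𝓞 K} (hx1 : x - 1 ∈ 𝔣)
    (hx : x - ((a : ZMod (p ^ n)).val : 𝓞 K) ∈ v.asIdeal ^ n)
    (ha : (a : ZMod (p ^ n)).val ≡ 1 [MOD p ^ (n - 1)]) :
    artinSymbol (galFrob K (rayClassField K (𝔣 * v.asIdeal ^ n))) (Ideal.span {x}) ∈
      relGalSet K (𝔣 * v.asIdeal ^ n) (𝔣 * v.asIdeal ^ (n - 1)) := by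
  refine artinSymbol_span_singleton_mem_relGalSet (mul_ne_zero h𝔣 (pow_ne_zero n v.ne_bot))
    (Ideal.mul_mono_right (Ideal.pow_le_pow_right (Nat.sub_le n 1))) (kappaRep_ne_zero hv hn a hx) ?_
  have hv' : x - 1 ∈ v.asIdeal ^ (n - 1) := by
    have h1 : x - ((a : ZMod (p ^ n)).val : 𝓞 K) ∈ v.asIdeal ^ (n - 1) :=
      Ideal.pow_le_pow_right (Nat.sub_le n 1) hx
    have h2 := natCast_sub_one_mem_pow (K := K) hv ha
    have := (v.asIdeal ^ (n - 1)).add_mem h1 h2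
    rwa [sub_add_sub_cancel] at this
  have hcop : IsCoprime 𝔣 (v.asIdeal ^ (n - 1)) := IsCoprime.pow_right h𝔣v
  rw [Ideal.mul_eq_inf_of_isCoprime hcop]
  exact Submodule.mem_inf.mpr ⟨hx1, hv'⟩

/-! ## §2 II.1.7: `δ : (ℤ/pⁿ)ˣ → Gal(K(𝔣vⁿ)/K)` is a homomorphism, independent of the representatives -/

omit [NumberField K] in
/-- `(a·b : ℤ/pⁿ).val ≡ a.val · b.val` read in `vⁿ`: `(a.val b.val : 𝓞 K) − ((ab).val : 𝓞 K) ∈ vⁿ`. -/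
theorem natCast_val_mul_sub_mem_pow {v : HeightOneSpectrum (𝓞 K)} (hv : ((p : ℕ) : 𝓞 K) ∈ v.asIdeal)
    {n : ℕ} (a b : ZMod (p ^ n)) :
    ((a.val : ℕ) : 𝓞 K) * ((b.val : ℕ) : 𝓞 K) - (((a * b).val : ℕ) : 𝓞 K) ∈ v.asIdeal ^ n := by
  have h : a.val * b.val = (a * b).val + p ^ n * (a.val * b.val / p ^ n) := by
    rw [ZMod.val_mul]; exact (Nat.mod_add_div _ _).symm
  have hcast : ((a.val : ℕ) : 𝓞 K) * ((b.val : ℕ) : 𝓞 K) - (((a * b).val : ℕ) : 𝓞 K) =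
      ((p ^ n : ℕ) : 𝓞 K) * ((a.val * b.val / p ^ n : ℕ) : 𝓞 K) := by
    have := congrArg (fun m : ℕ ↦ (m : 𝓞 K)) h
    simp only [Nat.cast_mul, Nat.cast_add] at this
    linear_combination this
  rw [hcast, Nat.cast_pow]
  exact Ideal.mul_mem_right _ _ (Ideal.pow_mem_pow hv n)

/-- **Independence of representatives / multiplicativity input**: two `κ`-representatives data
`x ≡ 1 (𝔣), x ≡ a (vⁿ)` and `y ≡ 1 (𝔣), y ≡ a (vⁿ)` of the SAME class have the same Artin symbol in
`K(𝔣vⁿ)` (the Artin symbol kills the ray mod `𝔣vⁿ`). -/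
theorem artinSymbol_kappaRep_congr [IsTotallyComplex K] {v : HeightOneSpectrum (𝓞 K)}
    (hv : ((p : ℕ) : 𝓞 K) ∈ v.asIdeal) {𝔣 : Ideal (𝓞 K)} (h𝔣 : 𝔣 ≠ ⊥)
    (h𝔣v : IsCoprime 𝔣 v.asIdeal) {n : ℕ} (hn : 1 ≤ n) (a : (ZMod (p ^ n))ˣ) {x y : 𝓞 K}
    (hx1 : x - 1 ∈ 𝔣) (hx : x - ((a : ZMod (p ^ n)).val : 𝓞 K) ∈ v.asIdeal ^ n)
    (hy1 : y - 1 ∈ 𝔣) (hy : y - ((a : ZMod (p ^ n)).val : 𝓞 K) ∈ v.asIdeal ^ n) :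
    artinSymbol (galFrob K (rayClassField K (𝔣 * v.asIdeal ^ n))) (Ideal.span {x}) =
      artinSymbol (galFrob K (rayClassField K (𝔣 * v.asIdeal ^ n))) (Ideal.span {y}) := by
  haveI := isEmpty_ringHom_real_of_isTotallyComplex K
  have h𝔤 : 𝔣 * v.asIdeal ^ n ≠ ⊥ := mul_ne_zero h𝔣 (pow_ne_zero n v.ne_bot)
  refine artinKillsRay_galFrob_rayClassField h𝔤 x y (kappaRep_ne_zero hv hn a hx)
    (kappaRep_ne_zero hv hn a hy) (isCoprime_span_kappaRep hv hn a hy1 hy) ?_ (fun φ ↦ isEmptyElim φ)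
  have hf : x - y ∈ 𝔣 := by
    have := 𝔣.sub_mem hx1 hy1; rwa [sub_sub_sub_cancel_right] at this
  have hvn : x - y ∈ v.asIdeal ^ n := by
    have := (v.asIdeal ^ n).sub_mem hx hy; rwa [sub_sub_sub_cancel_right] at this
  rw [Ideal.mul_eq_inf_of_isCoprime (IsCoprime.pow_right h𝔣v)]
  exact Submodule.mem_inf.mpr ⟨hf, hvn⟩

/-- **Multiplicativity**: `δ_{ab} = δ_a · δ_b` for any `κ`-representatives (II.1.7: `a ↦ δ_a` is the
isomorphism `(𝒪_K/𝔭ⁿ)ˣ ≅ Gal(K(𝔣𝔭ⁿ)/K(𝔣))` for `w_𝔣 = 1`; here only the homomorphism property). -/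
theorem artinSymbol_kappaRep_mul [IsTotallyComplex K] {v : HeightOneSpectrum (𝓞 K)}
    (hv : ((p : ℕ) : 𝓞 K) ∈ v.asIdeal) {𝔣 : Ideal (𝓞 K)} (h𝔣 : 𝔣 ≠ ⊥)
    (h𝔣v : IsCoprime 𝔣 v.asIdeal) {n : ℕ} (hn : 1 ≤ n) {α : (ZMod (p ^ n))ˣ → 𝓞 K}
    (hα : ∀ a, α a - 1 ∈ 𝔣 ∧ α a - ((a : ZMod (p ^ n)).val : 𝓞 K) ∈ v.asIdeal ^ n)
    (a b : (ZMod (p ^ n))ˣ) :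
    artinSymbol (galFrob K (rayClassField K (𝔣 * v.asIdeal ^ n))) (Ideal.span {α (a * b)}) =
      artinSymbol (galFrob K (rayClassField K (𝔣 * v.asIdeal ^ n))) (Ideal.span {α a}) *
        artinSymbol (galFrob K (rayClassField K (𝔣 * v.asIdeal ^ n))) (Ideal.span {α b}) := by
  have ha0 : Ideal.span {α a} ≠ ⊥ := by
    simpa [Ideal.span_singleton_eq_bot] using kappaRep_ne_zero hv hn a (hα a).2
  have hb0 : Ideal.span {α b} ≠ ⊥ := by
    simpa [Ideal.span_singleton_eq_bot] using kappaRep_ne_zero hv hn b (hα b).2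
  rw [← artinSymbol_mul _ ha0 hb0, Ideal.span_singleton_mul_span_singleton]
  -- `α_a α_b` is another representative of the class `ab`
  refine artinSymbol_kappaRep_congr hv h𝔣 h𝔣v hn (a * b) (hα (a * b)).1 (hα (a * b)).2 ?_ ?_
  · have : α a * α b - 1 = (α a - 1) * α b + (α b - 1) := by ring
    rw [this]
    exact 𝔣.add_mem (𝔣.mul_mem_right _ (hα a).1) (hα b).1
  · have : α a * α b - ((((a * b : (ZMod (p ^ n))ˣ) : ZMod (p ^ n)).val : ℕ) : 𝓞 K) =
        (α a - ((a : ZMod (p ^ n)).val : 𝓞 K)) * α b +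
          ((a : ZMod (p ^ n)).val : 𝓞 K) * (α b - ((b : ZMod (p ^ n)).val : 𝓞 K)) +
          ((((a : ZMod (p ^ n)).val : ℕ) : 𝓞 K) * (((b : ZMod (p ^ n)).val : ℕ) : 𝓞 K) -
            ((((a : ZMod (p ^ n)) * (b : ZMod (p ^ n))).val : ℕ) : 𝓞 K)) := by
      rw [Units.val_mul]; ring
    rw [this]
    exact (v.asIdeal ^ n).add_mem ((v.asIdeal ^ n).add_mem ((v.asIdeal ^ n).mul_mem_right _ (hα a).2)
      ((v.asIdeal ^ n).mul_mem_left _ (hα b).2)) (natCast_val_mul_sub_mem_pow hv _ _)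

/-- **The inertia-type homomorphism `δ : (ℤ/pⁿ)ˣ →* Gal(K(𝔣vⁿ)/K)`, `a ↦ ((α_a), K(𝔣vⁿ)/K)`**
(II.1.7 / II.4.11 (30): the parametrisation of `Gal(F_n/F)` by `κ`; values in `relGalSet K (𝔣vⁿ) 𝔣` by
`artinSymbol_kappaRep_mem_relGalSet`). -/
def kappaArtinHom [IsTotallyComplex K] {v : HeightOneSpectrum (𝓞 K)}
    (hv : ((p : ℕ) : 𝓞 K) ∈ v.asIdeal) {𝔣 : Ideal (𝓞 K)} (h𝔣 : 𝔣 ≠ ⊥)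
    (h𝔣v : IsCoprime 𝔣 v.asIdeal) {n : ℕ} (hn : 1 ≤ n) {α : (ZMod (p ^ n))ˣ → 𝓞 K}
    (hα : ∀ a, α a - 1 ∈ 𝔣 ∧ α a - ((a : ZMod (p ^ n)).val : 𝓞 K) ∈ v.asIdeal ^ n) :
    (ZMod (p ^ n))ˣ →* RayGal K (𝔣 * v.asIdeal ^ n) :=
  MonoidHom.mk' (fun a ↦ artinSymbol (galFrob K (rayClassField K (𝔣 * v.asIdeal ^ n))) (Ideal.span {α a}))
    (artinSymbol_kappaRep_mul hv h𝔣 h𝔣v hn hα)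

@[simp] theorem kappaArtinHom_apply [IsTotallyComplex K] {v : HeightOneSpectrum (𝓞 K)}
    (hv : ((p : ℕ) : 𝓞 K) ∈ v.asIdeal) {𝔣 : Ideal (𝓞 K)} (h𝔣 : 𝔣 ≠ ⊥)
    (h𝔣v : IsCoprime 𝔣 v.asIdeal) {n : ℕ} (hn : 1 ≤ n) {α : (ZMod (p ^ n))ˣ → 𝓞 K}
    (hα : ∀ a, α a - 1 ∈ 𝔣 ∧ α a - ((a : ZMod (p ^ n)).val : 𝓞 K) ∈ v.asIdeal ^ n)
    (a : (ZMod (p ^ n))ˣ) :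
    kappaArtinHom hv h𝔣 h𝔣v hn hα a =
      artinSymbol (galFrob K (rayClassField K (𝔣 * v.asIdeal ^ n))) (Ideal.span {α a}) := rfl

/-- The homomorphism does not depend on the choice of `κ`-representatives. -/
theorem kappaArtinHom_congr [IsTotallyComplex K] {v : HeightOneSpectrum (𝓞 K)}
    (hv : ((p : ℕ) : 𝓞 K) ∈ v.asIdeal) {𝔣 : Ideal (𝓞 K)} (h𝔣 : 𝔣 ≠ ⊥)
    (h𝔣v : IsCoprime 𝔣 v.asIdeal) {n : ℕ} (hn : 1 ≤ n) {α β : (ZMod (p ^ n))ˣ → 𝓞 K}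
    (hα : ∀ a, α a - 1 ∈ 𝔣 ∧ α a - ((a : ZMod (p ^ n)).val : 𝓞 K) ∈ v.asIdeal ^ n)
    (hβ : ∀ a, β a - 1 ∈ 𝔣 ∧ β a - ((a : ZMod (p ^ n)).val : 𝓞 K) ∈ v.asIdeal ^ n) :
    kappaArtinHom hv h𝔣 h𝔣v hn hα = kappaArtinHom hv h𝔣 h𝔣v hn hβ :=
  MonoidHom.ext fun a ↦ artinSymbol_kappaRep_congr hv h𝔣 h𝔣v hn a (hα a).1 (hα a).2 (hβ a).1 (hβ a).2

end KappaReps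

/-! ## §3 Gauss-factor rigidity: `G(χ⁻¹)·χ(γ₀|) = τ(χ ∘ δ)` depends on the inertia type only -/

section Gauss

variable {p : ℕ} [Fact p.Prime]

omit [NumberField K] in
/-- `ι⁻¹` is multiplicative on character values. -/
theorem cval_mul (ι : PadicAlgCl p ≃+* ℂ) (z w : ℂˣ) : cval ι (z * w) = cval ι z * cval ι w := by
  simp only [cval, Units.val_mul, map_mul, PadicComplex.coe_eq]

omit [NumberField K] in
/-- `ι⁻¹ 1 = 1`. -/
theorem cval_one (ι : PadicAlgCl p ≃+* ℂ) : cval ι 1 = 1 := by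
  simp only [cval, Units.val_one, map_one, PadicComplex.coe_eq]

omit [NumberField K] in
/-- `ι⁻¹(z⁻¹) · ι⁻¹(z) = 1`. -/
theorem cval_inv_mul_self (ι : PadicAlgCl p ≃+* ℂ) (z : ℂˣ) : cval ι z⁻¹ * cval ι z = 1 := by
  rw [← cval_mul, inv_mul_cancel, cval_one]

/-- **`τ`-form of the tree's Gauss factor** (print p. 80: "`G(χ⁻¹) = χ⁻¹(𝔮)τ(χ⁻¹)`", with `γ₀` in the
rôle of `σ_𝔮` and (19) `τ(χ) = p⁻ⁿ Σ_{γ ∈ Gal(F_n/F)} χ(γ) ζ_n^{−κ(γ)}`):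
`gaussSumInv · ι⁻¹χ(γ₀|_{K(𝔤)}) = p⁻ⁿ Σ_a ι⁻¹χ(δ_a)⁻¹ · j_p(γ₀ζ)^{−a}`. -/
theorem gaussSumInv_mul_cval (ι : PadicAlgCl p ≃+* ℂ) (ιK : K →+* ℂ) (𝔤 : Ideal (𝓞 K)) (n : ℕ)
    (χ : RayGal K 𝔤 →* ℂˣ) (γ₀ : absoluteGaloisGroup K) (ζ : AlgebraicClosure K)
    (α : (ZMod (p ^ n))ˣ → 𝓞 K) :
    gaussSumInv ι ιK 𝔤 n χ γ₀ ζ α * cval ι (χ (absRestrictNormalHom (rayClassField K 𝔤) γ₀)) =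
      ((p : ℂ_[p]) ^ n)⁻¹ * ∑ a : (ZMod (p ^ n))ˣ,
        cval ι (χ (artinSymbol (galFrob K (rayClassField K 𝔤)) (Ideal.span {α a})))⁻¹ *
          ((pEmb ι ιK (γ₀ • ζ)) ^ (a : ZMod (p ^ n)).val)⁻¹ := by
  unfold gaussSumInv
  set S := ∑ a : (ZMod (p ^ n))ˣ,
        cval ι (χ (artinSymbol (galFrob K (rayClassField K 𝔤)) (Ideal.span {α a})))⁻¹ *
          ((pEmb ι ιK (γ₀ • ζ)) ^ (a : ZMod (p ^ n)).val)⁻¹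
  set c := χ (absRestrictNormalHom (rayClassField K 𝔤) γ₀)
  calc ((p : ℂ_[p]) ^ n)⁻¹ * cval ι c⁻¹ * S * cval ι c
      = ((p : ℂ_[p]) ^ n)⁻¹ * S * (cval ι c⁻¹ * cval ι c) := by ring
    _ = ((p : ℂ_[p]) ^ n)⁻¹ * S := by rw [cval_inv_mul_self, mul_one]

/-- **Inertia-type form**: if `χ(δ_a) = θ(a)` for a character `θ` of `(ℤ/pⁿ)ˣ` (the INERTIA TYPE of `χ`,
e.g. `θ = χ ∘ kappaArtinHom`), then `gaussSumInv · ι⁻¹χ(γ₀|) = p⁻ⁿ Σ_a ι⁻¹θ(a)⁻¹ j_p(γ₀ζ)^{−a}` —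
the classical Gauss sum of `θ⁻¹` against the `pⁿ`-th root of unity `j_p(γ₀ζ)`: the `𝔣`-part of `χ`
enters `G(χ⁻¹)` only through the single value `χ(γ₀|)`. -/
theorem gaussSumInv_mul_cval_eq_of_inertiaType (ι : PadicAlgCl p ≃+* ℂ) (ιK : K →+* ℂ)
    (𝔤 : Ideal (𝓞 K)) (n : ℕ) (χ : RayGal K 𝔤 →* ℂˣ) (γ₀ : absoluteGaloisGroup K)
    (ζ : AlgebraicClosure K) (α : (ZMod (p ^ n))ˣ → 𝓞 K) (θ : (ZMod (p ^ n))ˣ →* ℂˣ)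
    (hθ : ∀ a, χ (artinSymbol (galFrob K (rayClassField K 𝔤)) (Ideal.span {α a})) = θ a) :
    gaussSumInv ι ιK 𝔤 n χ γ₀ ζ α * cval ι (χ (absRestrictNormalHom (rayClassField K 𝔤) γ₀)) =
      ((p : ℂ_[p]) ^ n)⁻¹ * ∑ a : (ZMod (p ^ n))ˣ,
        cval ι (θ a)⁻¹ * ((pEmb ι ιK (γ₀ • ζ)) ^ (a : ZMod (p ^ n)).val)⁻¹ := by
  rw [gaussSumInv_mul_cval]
  simp_rw [hθ]

/-- **RIGIDITY (D2 ⇒ Gauss factor depends only on `χ|_{Gal(K(𝔤)/K(𝔣))}`)**: for `0 ≠ 𝔤 ≤ 𝔣`,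
representatives `α_a ≠ 0`, `α_a ≡ 1 (𝔣)`, and two characters `χ, χ′` of `Gal(K(𝔤)/K)` that AGREE ON
`relGalSet K 𝔤 𝔣`: `G(χ⁻¹)·χ(γ₀|) = G(χ′⁻¹)·χ′(γ₀|)` (print II.4.11 Remark (i), p. 65: "`G(ε)` … depends
only on `ε` as a whole"; (19) is a sum over `Gal(F_n/F)`). This is the typed reason the class keys'
Gauss digit is a function of the local type `θ` at `v` alone (road A″, STUB-PLAN v8.2 HARDEST (b)). -/
theorem gaussSumInv_mul_cval_congr [IsTotallyComplex K] {𝔣 𝔤 : Ideal (𝓞 K)} (h𝔤 : 𝔤 ≠ ⊥)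
    (hle : 𝔤 ≤ 𝔣) (ι : PadicAlgCl p ≃+* ℂ) (ιK : K →+* ℂ) (n : ℕ) {χ χ' : RayGal K 𝔤 →* ℂˣ}
    (hχ : ∀ σ ∈ relGalSet K 𝔤 𝔣, χ σ = χ' σ) (γ₀ : absoluteGaloisGroup K) (ζ : AlgebraicClosure K)
    {α : (ZMod (p ^ n))ˣ → 𝓞 K} (hα : ∀ a, α a ≠ 0 ∧ α a - 1 ∈ 𝔣) :
    gaussSumInv ι ιK 𝔤 n χ γ₀ ζ α * cval ι (χ (absRestrictNormalHom (rayClassField K 𝔤) γ₀)) =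
      gaussSumInv ι ιK 𝔤 n χ' γ₀ ζ α * cval ι (χ' (absRestrictNormalHom (rayClassField K 𝔤) γ₀)) := by
  rw [gaussSumInv_mul_cval, gaussSumInv_mul_cval]
  congr 1
  refine Finset.sum_congr rfl fun a _ ↦ ?_
  rw [hχ _ (artinSymbol_span_singleton_mem_relGalSet h𝔤 hle (hα a).1 (hα a).2)]

/-- The same rigidity for the honest `κ`-representatives of `IsCosetValues` (`𝔤 = 𝔣vⁿ`, `n ≥ 1`). -/
theorem gaussSumInv_mul_cval_congr_kappaRep [IsTotallyComplex K] {v : HeightOneSpectrum (𝓞 K)}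
    (hv : ((p : ℕ) : 𝓞 K) ∈ v.asIdeal) {𝔣 : Ideal (𝓞 K)} (h𝔣 : 𝔣 ≠ ⊥) {n : ℕ} (hn : 1 ≤ n)
    (ι : PadicAlgCl p ≃+* ℂ) (ιK : K →+* ℂ) {χ χ' : RayGal K (𝔣 * v.asIdeal ^ n) →* ℂˣ}
    (hχ : ∀ σ ∈ relGalSet K (𝔣 * v.asIdeal ^ n) 𝔣, χ σ = χ' σ) (γ₀ : absoluteGaloisGroup K)
    (ζ : AlgebraicClosure K) {α : (ZMod (p ^ n))ˣ → 𝓞 K}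
    (hα : ∀ a, α a - 1 ∈ 𝔣 ∧ α a - ((a : ZMod (p ^ n)).val : 𝓞 K) ∈ v.asIdeal ^ n) :
    gaussSumInv ι ιK (𝔣 * v.asIdeal ^ n) n χ γ₀ ζ α *
        cval ι (χ (absRestrictNormalHom (rayClassField K (𝔣 * v.asIdeal ^ n)) γ₀)) =
      gaussSumInv ι ιK (𝔣 * v.asIdeal ^ n) n χ' γ₀ ζ α *
        cval ι (χ' (absRestrictNormalHom (rayClassField K (𝔣 * v.asIdeal ^ n)) γ₀)) :=
  gaussSumInv_mul_cval_congr (mul_ne_zero h𝔣 (pow_ne_zero n v.ne_bot)) Ideal.mul_le_right ι ιK n hχ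
    γ₀ ζ fun a ↦ ⟨kappaRep_ne_zero hv hn a (hα a).2, (hα a).1⟩

end Gauss

/-! ## §4 K2 (c) in tree currency ⇒ the binder `hχ` of `IsCosetValues` / `exists_cosetValueIdentity` -/

section LevelFromType

variable {p : ℕ}

/-- **K2 (c), typed**: «the inertia type of `χ` at `v` has EXACT level `n`» — the character
`a ↦ χ(δ_a)` of `(ℤ/pⁿ)ˣ ≅ (𝒪_v/vⁿ)ˣ` (split `v`, `𝒪_v = ℤ_p`) is nontrivial on the kernel of
reduction to `(ℤ/p^{n-1})ˣ`. For the class keys of the crux (minimal models of `49a1^{(d)}`,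
`49a2^{(d)}`, `4 ∣ d_{ℚ(√d)}`, `p = 2` split in `K₀ = ℚ(√−7)`) this is the assertion that
`θ = (ψ_{E^{(d)}}λ⁻¹)|_{𝒪_v^×}` has conductor exponent exactly `n` — the K2 (c) input, NOT proved here
(sources: de Shalit II.1.7 (p. 37), II.4.11 (30) (p. 65); Silverman ATAEC II §9 Thm 9.2 (p. 164–166:
"the reciprocity map sends `R_𝔓^*` to `I_𝔓^{ab}`"); the tree's local untwist P52 `PrintCf2SplitBadTwoLocalUntwist`). -/
def HasExactInertiaLevel (v : HeightOneSpectrum (𝓞 K)) (𝔣 : Ideal (𝓞 K)) (n : ℕ)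
    (α : (ZMod (p ^ n))ˣ → 𝓞 K) (χ : RayGal K (𝔣 * v.asIdeal ^ n) →* ℂˣ) : Prop :=
  ∃ a : (ZMod (p ^ n))ˣ, (a : ZMod (p ^ n)).val ≡ 1 [MOD p ^ (n - 1)] ∧
    χ (artinSymbol (galFrob K (rayClassField K (𝔣 * v.asIdeal ^ n))) (Ideal.span {α a})) ≠ 1

/-- **K2 (c) ⇒ `hχ`.** An inertia type of exact level `n` yields the binder
`∃ δ ∈ relGalSet K (𝔣vⁿ) (𝔣v^{n-1}), χ δ ≠ 1` of the tree's `IsCosetValues` /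
`exists_cosetValueIdentity` — by the level-`(n−1)` membership lemma. -/
theorem exists_mem_relGalSet_ne_one_of_hasExactInertiaLevel [IsTotallyComplex K]
    {v : HeightOneSpectrum (𝓞 K)} (hv : ((p : ℕ) : 𝓞 K) ∈ v.asIdeal) {𝔣 : Ideal (𝓞 K)}
    (h𝔣 : 𝔣 ≠ ⊥) (h𝔣v : IsCoprime 𝔣 v.asIdeal) {n : ℕ} (hn : 1 ≤ n)
    {α : (ZMod (p ^ n))ˣ → 𝓞 K}
    (hα : ∀ a, α a - 1 ∈ 𝔣 ∧ α a - ((a : ZMod (p ^ n)).val : 𝓞 K) ∈ v.asIdeal ^ n)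
    {χ : RayGal K (𝔣 * v.asIdeal ^ n) →* ℂˣ} (hχ : HasExactInertiaLevel v 𝔣 n α χ) :
    ∃ δ ∈ relGalSet K (𝔣 * v.asIdeal ^ n) (𝔣 * v.asIdeal ^ (n - 1)), χ δ ≠ 1 := by
  obtain ⟨a, ha, hne⟩ := hχ
  exact ⟨_, artinSymbol_kappaRep_mem_relGalSet_pred hv h𝔣 h𝔣v hn a (hα a).1 (hα a).2 ha, hne⟩

/-- **The same, phrased through a given inertia character `θ`** (`χ(δ_a) = θ(a)`, e.g.
`θ = χ ∘ kappaArtinHom`): `θ` nontrivial on `ker((ℤ/pⁿ)ˣ → (ℤ/p^{n-1})ˣ)` ⇒ `hχ`. -/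
theorem exists_mem_relGalSet_ne_one_of_inertiaType [IsTotallyComplex K]
    {v : HeightOneSpectrum (𝓞 K)} (hv : ((p : ℕ) : 𝓞 K) ∈ v.asIdeal) {𝔣 : Ideal (𝓞 K)}
    (h𝔣 : 𝔣 ≠ ⊥) (h𝔣v : IsCoprime 𝔣 v.asIdeal) {n : ℕ} (hn : 1 ≤ n)
    {α : (ZMod (p ^ n))ˣ → 𝓞 K}
    (hα : ∀ a, α a - 1 ∈ 𝔣 ∧ α a - ((a : ZMod (p ^ n)).val : 𝓞 K) ∈ v.asIdeal ^ n)
    (χ : RayGal K (𝔣 * v.asIdeal ^ n) →* ℂˣ) (θ : (ZMod (p ^ n))ˣ →* ℂˣ)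
    (hθ : ∀ a, χ (artinSymbol (galFrob K (rayClassField K (𝔣 * v.asIdeal ^ n))) (Ideal.span {α a})) = θ a)
    (hprim : ∃ a : (ZMod (p ^ n))ˣ, (a : ZMod (p ^ n)).val ≡ 1 [MOD p ^ (n - 1)] ∧ θ a ≠ 1) :
    ∃ δ ∈ relGalSet K (𝔣 * v.asIdeal ^ n) (𝔣 * v.asIdeal ^ (n - 1)), χ δ ≠ 1 := by
  obtain ⟨a, ha, hne⟩ := hprim
  exact exists_mem_relGalSet_ne_one_of_hasExactInertiaLevel hv h𝔣 h𝔣v hn hα ⟨a, ha, by rwa [hθ]⟩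

end LevelFromType

/-! ## §5 B82 — the glue AT ITS INSTANTIATION: K2 (c) in tree currency feeds the tree's
`DeShalit1987.exists_cosetValueIdentity` (II.5.2 (4) on every `IsCosetValues` witness) -/

section Instantiation

variable {p : ℕ}

/-- `HasExactInertiaLevel` does not depend on the choice of `κ`-representatives (the Artin symbol
kills the ray mod `𝔣vⁿ`), so K2 (c) may be stated for ANY family of representatives — in particular
for the family that `exists_cosetValueIdentity` outputs. -/
theorem hasExactInertiaLevel_congr [IsTotallyComplex K] {v : HeightOneSpectrum (𝓞 K)}
    (hv : ((p : ℕ) : 𝓞 K) ∈ v.asIdeal) {𝔣 : Ideal (𝓞 K)} (h𝔣 : 𝔣 ≠ ⊥)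
    (h𝔣v : IsCoprime 𝔣 v.asIdeal) {n : ℕ} (hn : 1 ≤ n) {α β : (ZMod (p ^ n))ˣ → 𝓞 K}
    (hα : ∀ a, α a - 1 ∈ 𝔣 ∧ α a - ((a : ZMod (p ^ n)).val : 𝓞 K) ∈ v.asIdeal ^ n)
    (hβ : ∀ a, β a - 1 ∈ 𝔣 ∧ β a - ((a : ZMod (p ^ n)).val : 𝓞 K) ∈ v.asIdeal ^ n)
    (χ : RayGal K (𝔣 * v.asIdeal ^ n) →* ℂˣ) :
    HasExactInertiaLevel v 𝔣 n α χ ↔ HasExactInertiaLevel v 𝔣 n β χ := by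
  unfold HasExactInertiaLevel
  refine exists_congr fun a ↦ and_congr_right fun _ ↦ ?_
  rw [artinSymbol_kappaRep_congr hv h𝔣 h𝔣v hn a (hα a).1 (hα a).2 (hβ a).1 (hβ a).2]

variable [Fact p.Prime]

/-- **B82 — THE GLUE AT ITS INSTANTIATION (kernel-checked against the receptacle of record).**
Every binder below is VERBATIM a binder of the tree's `DeShalit1987.exists_cosetValueIdentity`
(P56, the consumer form of `IsCosetValues`), except that its abstract exact-level binder
`hχ : ∃ δ ∈ relGalSet K (𝔣vⁿ) (𝔣vⁿ⁻¹), χ δ ≠ 1` is REPLACED by K2 (c) in tree currency,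
`HasExactInertiaLevel v 𝔣 n β χ` for an arbitrary family `β` of `κ`-representatives (which exists by the
tree's `exists_kappaReps`). Output: II.5.2 (4) (`CosetValueIdentity`) for `χ` on the witness `μ`, with
`κ`-representatives `α` for which `χ` AGAIN has exact inertia level `n` (so §3's inertia-type form of
`G(χ⁻¹)` applies to the same `α`). BSD is not proved by this; the crux and the stub are not proved by
this; it shows that the CFT half of road A″'s K2 (c)/K3 meets the objects of record with no gap. -/
theorem exists_cosetValueIdentity_of_hasExactInertiaLevel
    (h24 : Literature.NumberTheory.ComplexMultiplication.EllipticUnits.DeShalit1987.prop24_i_mem_rayClassField)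
    (hK : IsImaginaryQuadratic K) {ι : PadicAlgCl p ≃+* ℂ} {v vbar : HeightOneSpectrum (𝓞 K)}
    (hv : ((p : ℕ) : 𝓞 K) ∈ v.asIdeal) (hvbar : ((p : ℕ) : 𝓞 K) ∈ vbar.asIdeal) (hne : vbar ≠ v)
    {S : Finset (HeightOneSpectrum (𝓞 K))} {𝒰 : SubgroupTower (absoluteGaloisGroup K)}
    {μ : GroupDistribution 𝒰 ℂ_[p]} (hU : ∀ n, IsOpen (𝒰.U n : Set (absoluteGaloisGroup K)))
    (hN : ⋂ n, (𝒰.U n : Set (absoluteGaloisGroup K)) ⊆ rayKer K p S)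
    (hcv : IsCosetValues ι v vbar S 𝒰 μ)
    (ιK : K →+* ℂ) (hιK : ∀ k : 𝓞 K, k ∈ v.asIdeal ↔ ‖ι.symm (ιK (k : K))‖ < 1)
    (𝔣 : Ideal (𝓞 K)) (n : ℕ) (hn : 1 ≤ n) (h𝔣 : 𝔣 ≠ ⊥) (h𝔣v : IsCoprime 𝔣 v.asIdeal)
    (hsupp : ∀ w : HeightOneSpectrum (𝓞 K), w.asIdeal ∣ 𝔣 ↔ (w ∈ S ∨ w = vbar))
    (hw : rootsOfUnityCongruentOne 𝔣 = 1)
    (𝔞 : Ideal (𝓞 K)) (h𝔞 : 𝔞 ≠ ⊥)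
    (hcop : IsCoprime 𝔞 (Ideal.span {(6 : 𝓞 K)} * (𝔣 * v.asIdeal ^ n)))
    (χ : RayGal K (𝔣 * v.asIdeal ^ n) →* ℂˣ)
    {β : (ZMod (p ^ n))ˣ → 𝓞 K}
    (hβ : ∀ a, β a - 1 ∈ 𝔣 ∧ β a - ((a : ZMod (p ^ n)).val : 𝓞 K) ∈ v.asIdeal ^ n)
    (hlev : HasExactInertiaLevel v 𝔣 n β χ) :
    ∃ (L La : PeriodPair) (T : Finset ℂ) (u : rayClassField K (𝔣 * v.asIdeal ^ n))
      (ζ : AlgebraicClosure K) (γ₀ : absoluteGaloisGroup K) (α : (ZMod (p ^ n))ˣ → 𝓞 K),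
      (∀ z : ℂ, z ∈ L.lattice ↔ ∃ a ∈ 𝔣 * v.asIdeal ^ n, z = ιK (a : K)) ∧
      La.lattice = idealInvLattice ιK 𝔞 L.lattice ∧ L.IsLatticeReps La T ∧
      algClosureEmb ιK (u : AlgebraicClosure K) = L.deShalitTheta La T 1 ∧
      algClosureEmb ιK ζ = Complex.exp (2 * Real.pi * Complex.I / (p : ℂ) ^ n) ∧
      (∀ m : ℕ, absRestrictNormalHom (rayClassField K (𝔣 * vbar.asIdeal ^ m)) γ₀ =
        artinSymbol (galFrob K (rayClassField K (𝔣 * vbar.asIdeal ^ m))) (v.asIdeal ^ n)) ∧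
      (∀ a, α a - 1 ∈ 𝔣 ∧ α a - ((a : ZMod (p ^ n)).val : 𝓞 K) ∈ v.asIdeal ^ n) ∧
      HasExactInertiaLevel v 𝔣 n α χ ∧
      CosetValueIdentity ι ιK (𝔣 * v.asIdeal ^ n) n 𝔞 χ u γ₀ ζ α μ := by
  haveI : IsTotallyComplex K := hK.2
  obtain ⟨L, La, T, u, ζ, γ₀, α, hL, hLa, hT, hu, hζ, hγ₀, hα, hcvi⟩ :=
    exists_cosetValueIdentity h24 hK hv hvbar hne hU hN hcv ιK hιK 𝔣 n hn h𝔣 h𝔣v hsupp hw 𝔞 h𝔞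
      hcop χ (exists_mem_relGalSet_ne_one_of_hasExactInertiaLevel hv h𝔣 h𝔣v hn hβ hlev)
  exact ⟨L, La, T, u, ζ, γ₀, α, hL, hLa, hT, hu, hζ, hγ₀, hα,
    (hasExactInertiaLevel_congr hv h𝔣 h𝔣v hn hβ hα χ).mp hlev, hcvi⟩

end Instantiation

end Summit.BirchSwinnertonDyer.BirchSwinnertonDyer.Cruxes.SplitBadTwoLowerHalfOfFacts.GaussDictK2G47

end
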